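import Literature.NumberTheory.Automorphic.LevelActionReductionConnecting
import Literature.NumberTheory.Automorphic.LevelActionReductionSurjective
import Literature.NumberTheory.Automorphic.HidaLatticeHeckeCommutative
import HarnessLib

/-!
# Annihilators of `H^•(U, ⨂_τ Sym(𝒪²))` kill `H^•(U, ⨂_τ Sym((𝒪/ϖ)²))` (squared in degree one)

Topic `NumberTheory/Automorphic`; namespaces `Literature.NumberTheory.Automorphic.PolyAction` (one
generic lemma) and `…BigHeckeGLn.TameLevel`; theorems only (no named fact, no `sorry`).

`GL₂` over a number field `F`, tame level `U` maximal above `p`, a level `U(b, c)` inside the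
integral monoid of a family of places above `p`, the `𝒪`-lattice coefficients `⨂_τ Sym^{k−2}(𝒪²)`
(`𝒪` a domain, `ϖ ∈ 𝒪 ∖ 0`) and their reduction `⨂_τ Sym^{k−2}((𝒪/ϖ)²)`, and the polynomial
actions `π_𝒪`, `π_{𝒪/ϖ}` of the symbol ring `𝒪[Syms]` (`symPolyHom`, scalars through `id` resp.
`𝒪 → 𝒪/ϖ`).  For `z ∈ 𝒪[Syms]`:

* `PolyAction.addMonoidHom_polyHom_apply` — an additive map intertwining the generators and the
  scalars intertwines the polynomial actions;
* `reductionCohomology_symPolyHom_apply`, `reductionDelta_symPolyHom_apply` — the reduction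
  `H^j(𝒪) → H^j(𝒪/ϖ)` and the connecting map `δ : H^i(𝒪/ϖ) → H^{i+1}(𝒪)` intertwine `π`;
* **`symPolyHom_apply_eq_zero_of_subsingleton`** — if `π_𝒪(z)` kills `H^j(U, Sym(𝒪²))` and
  `H^{j+1}(U, Sym(𝒪²)) = 0`, then `π_{𝒪/ϖ}(z)` kills `H^j(U, Sym((𝒪/ϖ)²))` (reduction onto);
* **`symPolyHom_symPolyHom_apply_eq_zero`** — if `π_𝒪(z)` kills `H^i` AND `H^{i+1}` of
  `Sym(𝒪²)`, then `π_{𝒪/ϖ}(z)²` kills `H^i(U, Sym((𝒪/ϖ)²))`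
  (`δ(π z y) = π z δ y = 0`, so `π z y` is a reduction, killed by `π z`).

This is the step "an annihilator of the characteristic-`0` lattice cohomology (nearly) annihilates
the cohomology modulo `pⁿ`, uniformly in `n`" of the proof of Hida's control theorem for the
dominant ordinary points. [cite: Hida1994AIF, §3, proof of Thm 3.2] [cite: KhareThorne2017, §6.4–6.5]

## References

* H. Hida, Ann. Inst. Fourier 44 (1994), §3 (held). [Hida1994AIF]
* C. Khare, J. A. Thorne, Amer. J. Math. 139 (2017), §6.4–6.5 (arXiv:1409.7007, held). [KhareThorne2017]
* K. S. Brown, *Cohomology of Groups*, GTM 87 (1982), III.6 (held). [Brown1982CohomologyGroups]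
-/

noncomputable section

open CategoryTheory IsDedekindDomain MvPolynomial
open scoped NumberField

namespace Literature.NumberTheory.Automorphic

/-! ### Additive maps intertwining polynomial actions -/

namespace PolyAction

/-- **An additive map intertwining the generators and the scalars intertwines the polynomial
actions** (`polyHom` with possibly different scalar maps `φ`, `φ'`). [folklore] -/
theorem addMonoidHom_polyHom_apply {σ O S S' : Type} [CommRing O] [CommRing S] [CommRing S'] {φ : O →+* S}
    {φ' : O →+* S'} {M M' : Type} [AddCommGroup M] [Module S M] [AddCommGroup M'] [Module S' M']
    {t : σ → Module.End S M} (ht : ∀ a b, Commute (t a) (t b)) {t' : σ → Module.End S' M'}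
    (ht' : ∀ a b, Commute (t' a) (t' b)) (Φ : M →+ M') (hΦt : ∀ a m, Φ (t a m) = t' a (Φ m))
    (hΦC : ∀ (r : O) (m : M), Φ (φ r • m) = φ' r • Φ m) (z : MvPolynomial σ O) (m : M) :
    Φ (polyHom φ t ht z m) = polyHom φ' t' ht' z (Φ m) :=
  map_polyHom_apply ht ht' (RingHom.id _) (fun _ => rfl) Φ
    (fun a m => by rw [RingHom.id_apply, polyHom_X]; exact hΦt a m) hΦC z m

end PolyAction

namespace BigHeckeGLn

namespace TameLevel

open IntegralWeightGL2 LevelAction ParallelWeight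

variable {F : Type} [Field F] [NumberField F] {p : ℕ} [Fact p.Prime] (𝒰 : TameLevel 2 F p)
  (O : Type) [CommRing O] [IsDomain O] {E : Type} [Field E] [CharZero E] (k : ℕ)
  {v : (F →+* E) → HeightOneSpectrum (𝓞 F)} (hv : ∀ τ, (p : 𝓞 F) ∈ (v τ).asIdeal)
  (φO : ∀ τ : F →+* E, (v τ).adicCompletionIntegers F →+* O) {ϖ : O} (hϖ : ϖ ≠ 0)
  {b c : ℕ} (hU : (𝒰.level b c).toSubmonoid ≤ integralMonoid F v) (h𝒰 : 𝒰.IsMaximalAbove) (c₀ : ℕ)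

/-- The connecting homomorphism `δ : H^i(U, Sym((𝒪/ϖ)²)) →+ H^j(U, Sym(𝒪²))` of
`0 → Sym(𝒪²) →ϖ Sym(𝒪²) → Sym((𝒪/ϖ)²) → 0`. [cite: Hida1994AIF, §3] -/
abbrev latDelta (i j : ℕ) (hij : i + 1 = j) :
    LevelAction.cohomology (globalEmbedding 2 F) (integralMonoid F v)
        (symLatticeAction (O ⧸ Ideal.span {ϖ}) E F k v fun τ => (Ideal.Quotient.mk (Ideal.span {ϖ})).comp (φO τ))
        (𝒰.level b c) i →+
      LevelAction.cohomology (globalEmbedding 2 F) (integralMonoid F v) (symLatticeAction O E F k v φO) (𝒰.level b c) j :=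
  reductionDelta (globalEmbedding 2 F) (integralMonoid F v) (symLatticeAction O E F k v φO)
    (symLatticeAction (O ⧸ Ideal.span {ϖ}) E F k v fun τ => (Ideal.Quotient.mk (Ideal.span {ϖ})).comp (φO τ))
    (𝒰.level b c) hU (latticeReduce O E F k (Ideal.span {ϖ}))
    (fun g x => latticeReduce_symLatticeAction O E F k v φO (Ideal.span {ϖ}) g x) ϖ
    (fun x hx => smul_lattice_eq_zero O E F k ϖ hϖ x hx) (latticeReduce_eq_zero_iff O E F k ϖ)
    (latticeReduce_surjective O E F k _) i j hij

omit [IsDomain O] in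
/-- **Reduction intertwines the polynomial actions**: `red (π_𝒪(z) x) = π_{𝒪/ϖ}(z) (red x)`.
[cite: KhareThorne2017, §6.5] -/
theorem reductionCohomology_symPolyHom_apply (j : ℕ) (z : MvPolynomial (𝒰.Syms c₀) O)
    (x : LevelAction.cohomology (globalEmbedding 2 F) (integralMonoid F v) (symLatticeAction O E F k v φO) (𝒰.level b c) j) :
    reductionCohomology O E F k v φO (Ideal.span {ϖ}) (globalEmbedding 2 F) hU j
        (𝒰.symPolyHom (symLatticeAction O E F k v φO) hU c₀ (fun _ hg => 𝒰.goodElements_le_integralMonoid v hg)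
          (fun u => diamondPi_mem_integralMonoid' v hv u) (RingHom.id O) h𝒰 j z x) =
      𝒰.symPolyHom (symLatticeAction (O ⧸ Ideal.span {ϖ}) E F k v fun τ => (Ideal.Quotient.mk (Ideal.span {ϖ})).comp (φO τ))
        hU c₀ (fun _ hg => 𝒰.goodElements_le_integralMonoid v hg) (fun u => diamondPi_mem_integralMonoid' v hv u)
        (Ideal.Quotient.mk (Ideal.span {ϖ})) h𝒰 j z
        (reductionCohomology O E F k v φO (Ideal.span {ϖ}) (globalEmbedding 2 F) hU j x) := by
  refine PolyAction.addMonoidHom_polyHom_apply (𝒰.symOp_comm _ hU h𝒰 j) (𝒰.symOp_comm _ hU h𝒰 j)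
    (reductionCohomology O E F k v φO (Ideal.span {ϖ}) (globalEmbedding 2 F) hU j).toAddMonoidHom
    (fun a y => ?_) (fun r y => ?_) z x
  · rcases a with g | d
    · rw [symOp_inl, symOp_inl]
      exact reductionCohomology_heckeCohomology O E F k v φO (Ideal.span {ϖ}) (globalEmbedding 2 F) hU j _ y
    · rw [symOp_inr, symOp_inr]
      exact reductionCohomology_heckeCohomology O E F k v φO (Ideal.span {ϖ}) (globalEmbedding 2 F) hU j _ y
  · exact LinearMap.map_smulₛₗ (reductionCohomology O E F k v φO (Ideal.span {ϖ}) (globalEmbedding 2 F) hU j) r y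

/-- **The connecting map intertwines the polynomial actions**: `δ (π_{𝒪/ϖ}(z) y) = π_𝒪(z) (δ y)`.
[cite: Hida1994AIF, §3] [cite: KhareThorne2017, §6.4] -/
theorem latDelta_symPolyHom_apply {i j : ℕ} (hij : i + 1 = j) (z : MvPolynomial (𝒰.Syms c₀) O)
    (y : LevelAction.cohomology (globalEmbedding 2 F) (integralMonoid F v)
      (symLatticeAction (O ⧸ Ideal.span {ϖ}) E F k v fun τ => (Ideal.Quotient.mk (Ideal.span {ϖ})).comp (φO τ))
      (𝒰.level b c) i) :
    𝒰.latDelta O k φO hϖ hU i j hij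
        (𝒰.symPolyHom (symLatticeAction (O ⧸ Ideal.span {ϖ}) E F k v fun τ => (Ideal.Quotient.mk (Ideal.span {ϖ})).comp (φO τ))
          hU c₀ (fun _ hg => 𝒰.goodElements_le_integralMonoid v hg) (fun u => diamondPi_mem_integralMonoid' v hv u)
          (Ideal.Quotient.mk (Ideal.span {ϖ})) h𝒰 i z y) =
      𝒰.symPolyHom (symLatticeAction O E F k v φO) hU c₀ (fun _ hg => 𝒰.goodElements_le_integralMonoid v hg)
        (fun u => diamondPi_mem_integralMonoid' v hv u) (RingHom.id O) h𝒰 j z (𝒰.latDelta O k φO hϖ hU i j hij y) := by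
  refine PolyAction.addMonoidHom_polyHom_apply (𝒰.symOp_comm _ hU h𝒰 i) (𝒰.symOp_comm _ hU h𝒰 j)
    (𝒰.latDelta O k φO hϖ hU i j hij) (fun a y => ?_) (fun r y => ?_) z y
  · rcases a with g | d
    · rw [symOp_inl, symOp_inl]
      exact reductionDelta_heckeCohomology (globalEmbedding 2 F) (integralMonoid F v) _ _ (𝒰.level b c) hU _ _ ϖ _ _ _ hij _ y
    · rw [symOp_inr, symOp_inr]
      exact reductionDelta_heckeCohomology (globalEmbedding 2 F) (integralMonoid F v) _ _ (𝒰.level b c) hU _ _ ϖ _ _ _ hij _ y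
  · rw [RingHom.id_apply]
    exact reductionDelta_smul (globalEmbedding 2 F) (integralMonoid F v) _ _ (𝒰.level b c) hU _ _ ϖ _ _ _ hij r y

include hϖ in
/-- **If `π_𝒪(z)` kills `H^j(U, Sym(𝒪²))` and `H^{j+1}(U, Sym(𝒪²)) = 0`, then `π_{𝒪/ϖ}(z)` kills
`H^j(U, Sym((𝒪/ϖ)²))`** (the reduction is onto). [cite: Hida1994AIF, §3, proof of Thm 3.2] [cite: KhareThorne2017, §6.4] -/
theorem symPolyHom_apply_eq_zero_of_subsingleton (j : ℕ) (z : MvPolynomial (𝒰.Syms c₀) O)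
    (hz : ∀ x : LevelAction.cohomology (globalEmbedding 2 F) (integralMonoid F v) (symLatticeAction O E F k v φO) (𝒰.level b c) j,
      𝒰.symPolyHom (symLatticeAction O E F k v φO) hU c₀ (fun _ hg => 𝒰.goodElements_le_integralMonoid v hg)
        (fun u => diamondPi_mem_integralMonoid' v hv u) (RingHom.id O) h𝒰 j z x = 0)
    [Subsingleton (LevelAction.cohomology (globalEmbedding 2 F) (integralMonoid F v) (symLatticeAction O E F k v φO)
      (𝒰.level b c) (j + 1))]
    (y : LevelAction.cohomology (globalEmbedding 2 F) (integralMonoid F v)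
      (symLatticeAction (O ⧸ Ideal.span {ϖ}) E F k v fun τ => (Ideal.Quotient.mk (Ideal.span {ϖ})).comp (φO τ))
      (𝒰.level b c) j) :
    𝒰.symPolyHom (symLatticeAction (O ⧸ Ideal.span {ϖ}) E F k v fun τ => (Ideal.Quotient.mk (Ideal.span {ϖ})).comp (φO τ))
        hU c₀ (fun _ hg => 𝒰.goodElements_le_integralMonoid v hg) (fun u => diamondPi_mem_integralMonoid' v hv u)
        (Ideal.Quotient.mk (Ideal.span {ϖ})) h𝒰 j z y = 0 := by
  obtain ⟨x, rfl⟩ := reductionCohomology_surjective_of_subsingleton O E F k v φO ϖ (globalEmbedding 2 F) hU j hϖ y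
  rw [← 𝒰.reductionCohomology_symPolyHom_apply O k hv φO hU h𝒰 c₀ j z x, hz, map_zero]

include hϖ in
/-- **If `π_𝒪(z)` kills `H^i(U, Sym(𝒪²))` and `H^{i+1}(U, Sym(𝒪²))`, then `π_{𝒪/ϖ}(z)²` kills
`H^i(U, Sym((𝒪/ϖ)²))`**: `δ(π z y) = π z (δ y) = 0`, so `π z y` is the reduction of a class, which
`π z` kills. [cite: Hida1994AIF, §3, proof of Thm 3.2] [cite: KhareThorne2017, §6.4–6.5] -/
theorem symPolyHom_symPolyHom_apply_eq_zero {i j : ℕ} (hij : i + 1 = j) (z : MvPolynomial (𝒰.Syms c₀) O)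
    (hzi : ∀ x : LevelAction.cohomology (globalEmbedding 2 F) (integralMonoid F v) (symLatticeAction O E F k v φO) (𝒰.level b c) i,
      𝒰.symPolyHom (symLatticeAction O E F k v φO) hU c₀ (fun _ hg => 𝒰.goodElements_le_integralMonoid v hg)
        (fun u => diamondPi_mem_integralMonoid' v hv u) (RingHom.id O) h𝒰 i z x = 0)
    (hzj : ∀ x : LevelAction.cohomology (globalEmbedding 2 F) (integralMonoid F v) (symLatticeAction O E F k v φO) (𝒰.level b c) j,
      𝒰.symPolyHom (symLatticeAction O E F k v φO) hU c₀ (fun _ hg => 𝒰.goodElements_le_integralMonoid v hg)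
        (fun u => diamondPi_mem_integralMonoid' v hv u) (RingHom.id O) h𝒰 j z x = 0)
    (y : LevelAction.cohomology (globalEmbedding 2 F) (integralMonoid F v)
      (symLatticeAction (O ⧸ Ideal.span {ϖ}) E F k v fun τ => (Ideal.Quotient.mk (Ideal.span {ϖ})).comp (φO τ))
      (𝒰.level b c) i) :
    𝒰.symPolyHom (symLatticeAction (O ⧸ Ideal.span {ϖ}) E F k v fun τ => (Ideal.Quotient.mk (Ideal.span {ϖ})).comp (φO τ))
        hU c₀ (fun _ hg => 𝒰.goodElements_le_integralMonoid v hg) (fun u => diamondPi_mem_integralMonoid' v hv u)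
        (Ideal.Quotient.mk (Ideal.span {ϖ})) h𝒰 i z
      (𝒰.symPolyHom (symLatticeAction (O ⧸ Ideal.span {ϖ}) E F k v fun τ => (Ideal.Quotient.mk (Ideal.span {ϖ})).comp (φO τ))
        hU c₀ (fun _ hg => 𝒰.goodElements_le_integralMonoid v hg) (fun u => diamondPi_mem_integralMonoid' v hv u)
        (Ideal.Quotient.mk (Ideal.span {ϖ})) h𝒰 i z y) = 0 := by
  -- `δ (π z y) = π z (δ y) = 0`
  have hδ : 𝒰.latDelta O k φO hϖ hU i j hij
      (𝒰.symPolyHom (symLatticeAction (O ⧸ Ideal.span {ϖ}) E F k v fun τ => (Ideal.Quotient.mk (Ideal.span {ϖ})).comp (φO τ))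
        hU c₀ (fun _ hg => 𝒰.goodElements_le_integralMonoid v hg) (fun u => diamondPi_mem_integralMonoid' v hv u)
        (Ideal.Quotient.mk (Ideal.span {ϖ})) h𝒰 i z y) = 0 := by
    rw [𝒰.latDelta_symPolyHom_apply O k hv φO hϖ hU h𝒰 c₀ hij z y, hzj]
  -- so `π z y = red x`, and `π z (red x) = red (π z x) = 0`
  obtain ⟨x, hx⟩ := exists_of_reductionDelta_eq_zero (globalEmbedding 2 F) (integralMonoid F v) _ _ (𝒰.level b c) hU _ _ ϖ
    _ _ _ hij _ hδ
  rw [← hx]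
  have h := 𝒰.reductionCohomology_symPolyHom_apply O k hv φO (ϖ := ϖ) hU h𝒰 c₀ i z x
  rw [hzi, map_zero] at h
  exact h.symm

end TameLevel

end BigHeckeGLn

end Literature.NumberTheory.Automorphic
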